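import Literature.Topology.FourManifolds.CircleSurgeryDichotomy
import Literature.Topology.FourManifolds.CircleSurgerySymmetries
import Literature.Topology.FourManifolds.SphereFourCircleSurgery
import Literature.Topology.FourManifolds.SmoothEmbeddingCriteria
import Literature.Topology.FourManifolds.PalaisBallComplement
import Literature.Topology.FourManifolds.LinkSurgeryExistence
import HarnessLib

/-!
# Surgery on a loop of a copy of `S¹ × S³` homotopic to the fibre circle gives `S⁴` (Pao 1977)

Topic `Literature/Topology/FourManifolds`.  P. S. Pao, *The topology structure of 4-manifolds
with effective torus actions. I*, Trans. AMS 227 (1977): the two surgeries `S₁`, `S′₁` on the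
fibre circle `S¹ × {pt} ⊂ S¹ × S³` (the two framings, `π₁ SO(3) = ℤ/2`) are both `S⁴`;
R. Aranda, A. Zupan, arXiv:2503.04607 (2025), §2 p. 7: "When `p = 1`, we have that `S₁` and
`S′₁` are diffeomorphic to `S⁴`"; R. Kirby, *The topology of 4-manifolds* (1989), Ch. I §2;
R. Gompf, A. Stipsicz, *4-Manifolds and Kirby Calculus* (1999), §5.2.

The tree PROVES both model surgeries (`SphereFourCircleSurgery.lean`:
`isOpenGluing_circleSurgeryRel_tubeNbhd_sphereFour`, `…tubeNbhdTwist…`).  This file draws the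
consequence used by loop presentations of homotopy 4-spheres
(`Literature.Topology.FourManifolds.msz_loopSurgery_homotopySphere_gk`,
`LoopSurgeryHomotopySphere.lean`): **for a closed smooth `X` (charted on `ℝ⁴`) with a
diffeomorphism `Φ : X ≅ S¹ × S³` onto Mathlib's product manifold, a smoothly embedded loop `ℓ`
with `Φ ∘ ℓ` homotopic to the fibre circle `u ↦ (u, N)` or to its reverse `u ↦ (ū, N)`, and ANY
smooth `M` obtained from `X` by surgery on `ℓ` (`IsCircleSurgery`, either framing), `M ≅ S⁴`**
(`nonempty_diffeomorph_sphereFour_of_isCircleSurgery_of_homotopic_fibre`).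

Proof (ported from the Summits-side auxiliary file
`WeakReductionDescentWeakReductionReducesStubLoopFromGenusThreeAux1.lean`, which cannot be
imported into `Literature/`): (1) Whitney's theorem (`isSmoothlyIsotopic_circle_of_homotopic`)
and the isotopy extension theorem (`isAmbientIsotopic_of_isSmoothlyIsotopic_euclidean`) move `ℓ`
onto the model circle `c₀ = Φ⁻¹ ∘ (u ↦ (u, N))` (resp. `c₀ ∘ conj`), and the surgery presentation
moves with it (`IsCircleSurgery.map_diffeomorph`, `IsCircleSurgery.of_comp_circleConj`);
(2) `M` is then the surgery of `X` along SOME tube `ν` of `c₀` (uniqueness of gluings,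
`IsOpenGluing.nonempty_diffeomorph`), and a circle in a `4`-manifold has at most two framings
(`CircleNbhd.nonempty_diffeomorph_surgered_or_twist`): `ν.Surgered` is `ν₀.Surgered` or
`(ν₀.linTwist twist).Surgered` for the model tube `ν₀ = Φ⁻¹ ∘ tubeNbhd`; (3) both are `S⁴`,
transporting the two PROVED presentations of `S⁴` along `Φ⁻¹` — this needs a CROSS-MODEL
transport of tubes and of circle-surgery gluings (`CircleNbhd.exists_comp_diffeomorph`,
`IsOpenGluing.circleSurgeryRel_comp_diffeomorph`), built on the tree's cross-model composition of
open smooth embeddings (`isSmoothEmbedding_comp_of_isOpen_range`, `LinkSurgeryExistence.lean`) —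
and `ν₀.linTwist twist = Φ⁻¹ ∘ tubeNbhdTwist` because the twist loop of
`CircleFramingClassification` is the rotation `rotThree` of the twisted tube
(`OpLoop.twist_toFun_eq_rotThree`).

Everything is proved; no definitions, no named facts.

## References

* P. S. Pao, *The topology structure of 4-manifolds with effective torus actions. I*, Trans. AMS
  227 (1977), doi:10.2307/1997462. [Pao1977]
* R. Aranda, A. Zupan, arXiv:2503.04607 (2025), §2 (p. 7). [ArandaZupan2025]
* R. E. Gompf, A. I. Stipsicz, *4-Manifolds and Kirby Calculus* (1999), §5.2. [GompfStipsiczGSM1999]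
* R. C. Kirby, *The topology of 4-manifolds*, LNM 1374 (1989), Ch. I §2. [Kirby1989]
* A. Kosinski, *Differential Manifolds* (1993), Ch. VI §1 (transport of gluings). [Kosinski1993]
-/

noncomputable section

open scoped Manifold ContDiff Topology ContinuousMap
open Set Function

namespace Literature.Topology.FourManifolds

/-! ### Cross-model transport of tubes of circles and of circle-surgery gluings -/

section CircleTransport

variable {EX HX EY HY : Type*} [NormedAddCommGroup EX] [NormedSpace ℝ EX] [TopologicalSpace HX]
  [NormedAddCommGroup EY] [NormedSpace ℝ EY] [TopologicalSpace HY]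
  {IX : ModelWithCorners ℝ EX HX} {IY : ModelWithCorners ℝ EY HY}
  [IX.Boundaryless] [IY.Boundaryless]
  {X : Type*} [TopologicalSpace X] [ChartedSpace HX X] [IsManifold IX ∞ X]
  {Y : Type*} [TopologicalSpace Y] [ChartedSpace HY Y] [IsManifold IY ∞ Y]

omit [IY.Boundaryless] [IsManifold IY ∞ Y] in
/-- A point `ν (u, w)` of a tube of a circle (any model) lies on its core circle iff `w = 0`
(the same-model `(𝓡 4)` case is `CircleNbhd.apply_mem_range_iff`). [folklore] -/
theorem CircleNbhd.toFun_mem_range_iff {c : (Metric.sphere (0 : EuclideanSpace ℝ (Fin 2)) 1) → Y}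
    (ν : CircleNbhd IY c) {u : (Metric.sphere (0 : EuclideanSpace ℝ (Fin 2)) 1)}
    {w : EuclideanSpace ℝ (Fin 3)} :
    ν.toFun (u, w) ∈ range c ↔ w = 0 := by
  constructor
  · rintro ⟨u', h⟩
    rw [← ν.apply_zero] at h
    exact (congrArg Prod.snd (ν.isSmoothEmbedding.isEmbedding.injective h)).symm
  · rintro rfl
    exact ⟨u, (ν.apply_zero u).symm⟩

/-- **Transport of a tubular neighbourhood of a circle along a diffeomorphism between manifolds
with possibly different boundaryless models** (`L₃`, `L` identify the model vector spaces):
`Ψ ∘ ν` is (the underlying map of) a tube of `Ψ ∘ c` (the tree's `CircleNbhd.map` is the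
same-model case).  Stated as an existence so that no definition is introduced.
[cite: GompfStipsiczGSM1999, §5.2] -/
theorem CircleNbhd.exists_comp_diffeomorph
    {c : (Metric.sphere (0 : EuclideanSpace ℝ (Fin 2)) 1) → Y}
    (ν : CircleNbhd IY c) (Ψ : Y ≃ₘ⟮IY, IX⟯ X)
    (L₃ : ((EuclideanSpace ℝ (Fin 1)) × (EuclideanSpace ℝ (Fin 3))) ≃L[ℝ] EX) (L : EY ≃L[ℝ] EX) :
    ∃ ν' : CircleNbhd IX (Ψ ∘ c), ν'.toFun = Ψ ∘ ν.toFun := by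
  haveI : Nonempty Y := ⟨c (Classical.arbitrary _)⟩
  have hr : range (Ψ : Y → X) = univ :=
    Set.eq_univ_of_forall fun x ↦ ⟨Ψ.symm x, Ψ.apply_symm_apply x⟩
  refine ⟨{ toFun := Ψ ∘ ν.toFun
            isSmoothEmbedding := ?_
            isOpen_range := ?_
            apply_zero := fun u ↦ by simp only [Function.comp_apply, ν.apply_zero] }, rfl⟩
  · refine (isSmoothEmbedding_comp_of_isOpen_range
      (isSmoothEmbedding_diffeomorph_of_boundaryless Ψ L) ?_
      ν.isSmoothEmbedding ν.isOpen_range L₃).1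
    rw [hr]; exact isOpen_univ
  · rw [Set.range_comp]
    exact Ψ.toHomeomorph.isOpenMap _ ν.isOpen_range

variable [T2Space X] [T2Space Y]
  {EP HP : Type*} [NormedAddCommGroup EP] [NormedSpace ℝ EP] [TopologicalSpace HP]
  {IP : ModelWithCorners ℝ EP HP} [IP.Boundaryless]
  {P : Type*} [TopologicalSpace P] [ChartedSpace HP P] [IsManifold IP ∞ P]

/-- **Transport of a circle-surgery gluing along a cross-model diffeomorphism of the ambient
manifold**: if `P` is glued from `Y ∖ c` and `D̊² × S²` along the surgery relation of the tube
`ν`, then `P` is glued from `X ∖ Ψ(c)` and `D̊² × S²` along the relation of any tube `ν'` of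
`Ψ ∘ c` with underlying map `Ψ ∘ ν` — precompose the embedding of the complement with the
restriction of `Ψ⁻¹` (`opensCongr`); the relation is unchanged because both tubes carry the same
polar coordinates (Kosinski 1993, VI.1, transport of gluings; the tree's same-model
`IsCircleSurgery.map_diffeomorph`). [cite: Kosinski1993, Ch. VI §1, proof of Thm (1.1)] -/
theorem IsOpenGluing.circleSurgeryRel_comp_diffeomorph
    {c : (Metric.sphere (0 : EuclideanSpace ℝ (Fin 2)) 1) → Y}
    (ν : CircleNbhd IY c) (Ψ : Y ≃ₘ⟮IY, IX⟯ X) (L : EY ≃L[ℝ] EX) (LP : EX ≃L[ℝ] EP)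
    (ν' : CircleNbhd IX (Ψ ∘ c)) (hν' : ν'.toFun = Ψ ∘ ν.toFun)
    (h : IsOpenGluing IY (𝓘(ℝ, EuclideanSpace ℝ (Fin 2)).prod (𝓡 2)) IP (A := ↥ν.complement)
      (B := ↥discTimesSphere) (P := P) (circleSurgeryRel ν)) :
    IsOpenGluing IX (𝓘(ℝ, EuclideanSpace ℝ (Fin 2)).prod (𝓡 2)) IP (A := ↥ν'.complement)
      (B := ↥discTimesSphere) (P := P) (circleSurgeryRel ν') := by
  obtain ⟨jA, jB, hA, hAo, hB, hBo, hU, hR⟩ := h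
  -- the complements correspond under `Ψ⁻¹`
  let κ : ↥ν'.complement ≃ₘ⟮IX, IY⟯ ↥ν.complement :=
    opensCongr Ψ.symm _ _ fun x ↦ by
      simp only [CircleNbhd.mem_complement_iff, Set.mem_range, Function.comp_apply, not_exists]
      constructor
      · intro h u hu; exact h u (by rw [hu, Diffeomorph.apply_symm_apply])
      · intro h u hu; exact h u (by rw [← hu, Diffeomorph.symm_apply_apply])
  have hsurj : Function.Surjective (κ : _ → ↥ν.complement) := κ.surjective
  refine ⟨jA ∘ κ, jB, ?_, ?_, hB, hBo, ?_, fun a b ↦ ?_⟩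
  · refine (isSmoothEmbedding_comp_of_isOpen_range hA hAo
      (isSmoothEmbedding_diffeomorph_of_boundaryless κ L.symm) ?_ (L.symm.trans (L.trans LP))).1
    rw [hsurj.range_eq]; exact isOpen_univ
  · rwa [hsurj.range_comp]
  · rwa [hsurj.range_comp]
  · rw [Function.comp_apply, hR]
    simp only [circleSurgeryRel, hν', Function.comp_apply]
    refine exists_congr fun u ↦ exists_congr fun t ↦ and_congr_right fun _ ↦
      and_congr_right fun _ ↦ ?_
    have hκa : ((κ a : ↥ν.complement) : Y) = Ψ.symm (a : X) := rfl
    rw [hκa]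
    constructor
    · intro h1; rw [← h1, Diffeomorph.apply_symm_apply]
    · intro h1; rw [h1, Diffeomorph.symm_apply_apply]

end CircleTransport

/-! ### The end-game: both surgeries on the fibre circle of a copy of `S¹ × S³` give `S⁴` -/

section EndGame

open SphereFourSurgery GluckUnknot

/-- Two tubular neighbourhoods of the same circle with the same underlying map are equal.
[folklore] -/
theorem CircleNbhd.ext_toFun {EX HX : Type*} [NormedAddCommGroup EX] [NormedSpace ℝ EX]
    [TopologicalSpace HX] {IX : ModelWithCorners ℝ EX HX} {X : Type*} [TopologicalSpace X]
    [ChartedSpace HX X] {c : (Metric.sphere (0 : EuclideanSpace ℝ (Fin 2)) 1) → X}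
    {ν ν' : CircleNbhd IX c} (h : ν.toFun = ν'.toFun) : ν = ν' := by
  cases ν; cases ν'; cases h; rfl

/-- The twist loop of `CircleFramingClassification` (one full turn of the `(x₀, x₁)`-plane) acts
on `ℝ³` as the rotation `rotThree` of `GluckTwistUnknotProofs` used by the twisted tube
`SphereFourSurgery.tubeNbhdTwist`. [folklore] -/
theorem OpLoop.twist_toFun_eq_rotThree (u : (Metric.sphere (0 : EuclideanSpace ℝ (Fin 2)) 1))
    (w : EuclideanSpace ℝ (Fin 3)) :
    OpLoop.twist.toFun u w = rotThree (u : EuclideanSpace ℝ (Fin 2)) w := by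
  change matCLM (OpLoop.rotMat (u : EuclideanSpace ℝ (Fin 2))) w =
    rotThree (u : EuclideanSpace ℝ (Fin 2)) w
  rw [matCLM_apply]
  ext i
  rw [mulVecE_apply]
  fin_cases i
  · simp [OpLoop.rotMat, Fin.sum_univ_three]; ring
  · simp [OpLoop.rotMat, Fin.sum_univ_three]
  · simp [OpLoop.rotMat, Fin.sum_univ_three]

/-- **The core circle of a tubular neighbourhood in a smooth `4`-manifold is a smooth embedding**
(zero section of a product neighbourhood with smooth inverse on its open range; the tree's
`isImmersionAtOfComplement_of_eventuallyEq_prod`, as for `StdChart.isSmoothEmbedding_c`).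
[folklore] -/
theorem CircleNbhd.isSmoothEmbedding_core {X : Type*} [TopologicalSpace X] [T2Space X]
    [ChartedSpace (EuclideanSpace ℝ (Fin 4)) X] [IsManifold (𝓡 4) ∞ X]
    {c : (Metric.sphere (0 : EuclideanSpace ℝ (Fin 2)) 1) → X} (ν : CircleNbhd (𝓡 4) c) :
    Manifold.IsSmoothEmbedding (𝓡 1) (𝓡 4) ∞ c := by
  haveI := Fact.mk (@finrank_euclideanSpace_fin ℝ _ 2)
  have hO : Topology.IsOpenEmbedding ν.toFun := ⟨ν.isSmoothEmbedding.isEmbedding, ν.isOpen_range⟩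
  set T := hO.toOpenPartialHomeomorph ν.toFun with hT
  have hc : c = fun u ↦ T (u, 0) := funext fun u ↦ by
    rw [hT, Topology.IsOpenEmbedding.toOpenPartialHomeomorph_apply, ν.apply_zero]
  have hcont : Continuous c := by
    rw [hc]; exact hO.continuous.comp (by fun_prop)
  have hinj : Injective c := fun u v h ↦ by
    rw [← ν.apply_zero, ← ν.apply_zero] at h
    exact congrArg Prod.fst (hO.injective h)
  refine ⟨Manifold.IsImmersionOfComplement.isImmersion (F := (EuclideanSpace ℝ (Fin 3))) fun u ↦ ?_,
    (hcont.isClosedEmbedding hinj).isEmbedding⟩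
  refine isImmersionAtOfComplement_of_eventuallyEq_prod T ?_ ?_ StdCircleSurgery.tubeLin ?_
    (Filter.EventuallyEq.of_eq hc)
  · rw [hT, Topology.IsOpenEmbedding.toOpenPartialHomeomorph_source]
    exact ν.isSmoothEmbedding.contMDiff.contMDiffOn
  · have := contMDiffOn_symm_of_isSmoothEmbedding ν.isSmoothEmbedding hO
    rw [hT, Topology.IsOpenEmbedding.toOpenPartialHomeomorph_target]
    simpa using this
  · rw [hT, Topology.IsOpenEmbedding.toOpenPartialHomeomorph_source]; exact mem_univ _

/-- **Pao 1977 / Aranda–Zupan 2025 §2: surgery on a loop of a copy of `S¹ × S³` homotopic to the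
fibre circle, with either framing, gives `S⁴`.**  Let `X` be a closed smooth `4`-manifold
(charted on `ℝ⁴`) with a diffeomorphism `Φ : X ≅ S¹ × S³` (Mathlib's product manifold, model
`(𝓡 1).prod (𝓡 3)`), `ℓ` a smoothly embedded loop in `X` such that `Φ ∘ ℓ` is homotopic to the
fibre circle `u ↦ (u, N)` or to its reverse `u ↦ (ū, N)` (`circleConj`), and `M` a smooth
`4`-manifold obtained from `X` by surgery on `ℓ` (`IsCircleSurgery`, ANY tube, i.e. either
framing).  Then `M ≅ S⁴`.  Proof: Whitney + isotopy extension move `ℓ` to `Φ⁻¹ ∘ (u ↦ (u, N))`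
and the surgery with it; a circle has at most two framings
(`CircleNbhd.nonempty_diffeomorph_surgered_or_twist`); the two model surgeries are the transports
along `Φ⁻¹` of the two PROVED presentations of `S⁴` as a surgery on `S¹ × {N} ⊂ S¹ × S³`
(`isOpenGluing_circleSurgeryRel_tubeNbhd_sphereFour`, `…Twist…`; Pao 1977, `S₁ ≅ S′₁ ≅ S⁴`;
Aranda–Zupan 2025, §2 p. 7: "When `p = 1`, we have that `S₁` and `S′₁` are diffeomorphic to
`S⁴`"; Kirby 1989 Ch. I §2; Gompf–Stipsicz §5.2), identified by uniqueness of gluings.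
[cite: Pao1977, Thm (`S₁ ≅ S'₁ ≅ S⁴`)] [cite: ArandaZupan2025, §2 p. 7]
[cite: GompfStipsiczGSM1999, §5.2] -/
theorem nonempty_diffeomorph_sphereFour_of_isCircleSurgery_of_homotopic_fibre
    {X : Type*} [TopologicalSpace X] [T2Space X] [SecondCountableTopology X] [CompactSpace X]
    [ChartedSpace (EuclideanSpace ℝ (Fin 4)) X] [IsManifold (𝓡 4) ∞ X]
    (Φ : X ≃ₘ⟮𝓡 4, (𝓡 1).prod (𝓡 3)⟯ ((Metric.sphere (0 : EuclideanSpace ℝ (Fin 2)) 1) ×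
      (Metric.sphere (0 : EuclideanSpace ℝ (Fin 4)) 1)))
    (ℓ : C((Metric.sphere (0 : EuclideanSpace ℝ (Fin 2)) 1), X))
    (hℓ : Manifold.IsSmoothEmbedding (𝓡 1) (𝓡 4) ∞ ⇑ℓ)
    (hhom : (ContinuousMap.comp ⟨⇑Φ, Φ.continuous⟩ ℓ).Homotopic
        ((ContinuousMap.id _).prodMk (ContinuousMap.const _ SphereFourSurgery.northPole)) ∨
      (ContinuousMap.comp ⟨⇑Φ, Φ.continuous⟩ ℓ).Homotopic
        ((⟨⇑circleConj, circleConj.continuous⟩ : C(_, _)).prodMk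
          (ContinuousMap.const _ SphereFourSurgery.northPole)))
    {M : Type*} [TopologicalSpace M] [T2Space M] [ChartedSpace (EuclideanSpace ℝ (Fin 4)) M]
    [IsManifold (𝓡 4) ∞ M] (hsurg : IsCircleSurgery (𝓡 4) (𝓡 4) X M ⇑ℓ) :
    Nonempty (M ≃ₘ⟮𝓡 4, 𝓡 4⟯ (Metric.sphere (0 : EuclideanSpace ℝ (Fin 5)) 1)) := by
  haveI := Fact.mk (@finrank_euclideanSpace_fin ℝ _ 2)
  haveI := Fact.mk (@finrank_euclideanSpace_fin ℝ _ 4)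
  -- the model circle and its two tubes, transported to `X`
  set Ψ := Φ.symm with hΨ
  set c₀ : (Metric.sphere (0 : EuclideanSpace ℝ (Fin 2)) 1) → X := Ψ ∘ fibreCircle with hc₀def
  obtain ⟨ν₀, hν₀⟩ :=
    CircleNbhd.exists_comp_diffeomorph tubeNbhd Ψ StdCircleSurgery.tubeLin StdCircleSurgery.tubeLin
  obtain ⟨ν₁, hν₁⟩ :=
    CircleNbhd.exists_comp_diffeomorph tubeNbhdTwist Ψ StdCircleSurgery.tubeLin
      StdCircleSurgery.tubeLin
  have hc₀ : Manifold.IsSmoothEmbedding (𝓡 1) (𝓡 4) ∞ c₀ := ν₀.isSmoothEmbedding_core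
  -- Step 1: `M` is also the surgery along the model circle `c₀` (Whitney's isotopy, isotopy
  -- extension, transport of the surgery; the reversed circle by `of_comp_circleConj`)
  have key : ∀ e : C(_, X), Manifold.IsSmoothEmbedding (𝓡 1) (𝓡 4) ∞ ⇑e →
      ℓ.Homotopic e → IsCircleSurgery (𝓡 4) (𝓡 4) X M ⇑e := by
    intro e he hle
    obtain ⟨F, hF⟩ := isAmbientIsotopic_of_isSmoothlyIsotopic_euclidean (⇑ℓ) (⇑e)
      (isSmoothlyIsotopic_circle_of_homotopic (n := 4) le_rfl ℓ e hℓ he hle)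
    have hFe : (F.toDiffeomorph 1 : X → X) ∘ ⇑ℓ = ⇑e := by
      rw [F.coe_toDiffeomorph 1]; exact hF
    have h2 := hsurg.map_diffeomorph (F.toDiffeomorph 1)
    rwa [hFe] at h2
  let Ψc : C(_, X) := ⟨Ψ, Ψ.continuous⟩
  let Φc : C(X, _) := ⟨Φ, Φ.continuous⟩
  have hback : ∀ g : C(_, _), (Φc.comp ℓ).Homotopic g → ℓ.Homotopic (Ψc.comp g) := by
    intro g hg
    have h1 := (ContinuousMap.Homotopic.refl Ψc).comp hg
    have h2 : Ψc.comp (Φc.comp ℓ) = ℓ := by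
      ext1 u; exact Φ.symm_apply_apply (ℓ u)
    rwa [h2] at h1
  have h₀ : IsCircleSurgery (𝓡 4) (𝓡 4) X M c₀ := by
    rcases hhom with h | h
    · exact key (Ψc.comp ((ContinuousMap.id _).prodMk (ContinuousMap.const _ northPole)))
        hc₀ (hback _ h)
    · exact (key (Ψc.comp ((⟨⇑circleConj, circleConj.continuous⟩ : C(_, _)).prodMk
        (ContinuousMap.const _ northPole))) (hc₀.comp_diffeomorph circleConj)
        (hback _ h)).of_comp_circleConj
  -- Step 2: `M` is the surgery along SOME tube `ν` of `c₀`; compare with the model tube `ν₀`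
  obtain ⟨ν, hν⟩ := h₀
  obtain ⟨e₁⟩ := IsOpenGluing.nonempty_diffeomorph hν ν.isOpenGluing_surgered
  -- Step 3: both model surgeries are `S⁴` (Pao; the tree's `SphereFourCircleSurgery`)
  haveI := Fact.mk (@finrank_euclideanSpace_fin ℝ _ 5)
  have hS₀ : Nonempty (ν₀.Surgered ≃ₘ⟮𝓡 4, 𝓡 4⟯ (Metric.sphere (0 : EuclideanSpace ℝ (Fin 5)) 1)) :=
    IsOpenGluing.nonempty_diffeomorph ν₀.isOpenGluing_surgered
      (IsOpenGluing.circleSurgeryRel_comp_diffeomorph tubeNbhd Ψ StdCircleSurgery.tubeLin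
        (ContinuousLinearEquiv.refl ℝ (EuclideanSpace ℝ (Fin 4))) ν₀ hν₀
        isOpenGluing_circleSurgeryRel_tubeNbhd_sphereFour)
  have hS₁ : Nonempty (ν₁.Surgered ≃ₘ⟮𝓡 4, 𝓡 4⟯ (Metric.sphere (0 : EuclideanSpace ℝ (Fin 5)) 1)) :=
    IsOpenGluing.nonempty_diffeomorph ν₁.isOpenGluing_surgered
      (IsOpenGluing.circleSurgeryRel_comp_diffeomorph tubeNbhdTwist Ψ StdCircleSurgery.tubeLin
        (ContinuousLinearEquiv.refl ℝ (EuclideanSpace ℝ (Fin 4))) ν₁ hν₁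
        isOpenGluing_circleSurgeryRel_tubeNbhdTwist_sphereFour)
  have h01 : ν₀.linTwist OpLoop.twist = ν₁ :=
    CircleNbhd.ext_toFun (funext fun q ↦ by
      obtain ⟨u, w⟩ := q
      rw [CircleNbhd.linTwist_apply, hν₀, hν₁, Function.comp_apply, Function.comp_apply,
        OpLoop.twist_toFun_eq_rotThree, tubeNbhdTwist_apply])
  rcases CircleNbhd.nonempty_diffeomorph_surgered_or_twist ν₀ ν with h2 | h2
  · obtain ⟨e₂⟩ := h2
    exact ⟨e₁.trans (e₂.trans hS₀.some)⟩
  · rw [h01] at h2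
    obtain ⟨e₂⟩ := h2
    exact ⟨e₁.trans (e₂.trans hS₁.some)⟩

end EndGame

end Literature.Topology.FourManifolds

end
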